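import Literature.Analysis.Fourier.ConvolutionOperatorGradient
import HarnessLib

/-!
# Reflection-symmetric convolution kernels: a first difference is controlled by second differences

An elementary device of one-dimensional potential theory, used to bound TEMPORAL gradients of torus Green's functions
uniformly in the temporal period (where mode-by-mode bounds lose a logarithm): if a kernel is even under a reflection
that reverses the step `g` — `f(−n) = f(n)` for `f(n) := C(0, w + n•g)` — then its forward difference along `g` vanishes
"at the mirror" to first order, so it is bounded by `(|n| + 2)` times the supremum of its SECOND differences along `g`:

* `abs_forwardDiff_le_of_even` — for `f : ℤ → ℝ` even with `|f(j+1) − 2 f(j) + f(j−1)| ≤ B` for all `j`: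
  `|f(n+1) − f(n)| ≤ (|n| + 1)·B`;
* `abs_rowDiff_le_of_reflection` — for a translation-invariant real matrix `C` on an abelian group with
  `C (τ x) (τ y) = C x y`, `τ 0 = 0` and `τ (w + n•g) = w − n•g` for all integers `n` (a reflection reversing `g` and
  fixing `w`): `|∇_g C (x, x + w + n•g)| ≤ (|n| + 2) · sup_{x',n'} |∇_g∇_g C (x', x' + w + n'•g)|`.

[folklore]
-/

noncomputable section

namespace Literature.Analysis.Fourier

/-! ## Even functions on `ℤ` -/

/-- For an even `f : ℤ → ℝ` the forward difference is odd about `−½`: `g(−n−1) = −g(n)`, `g(n) = f(n+1) − f(n)`.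
[folklore] -/
theorem forwardDiff_neg_sub_one_of_even {f : ℤ → ℝ} (hf : ∀ n, f (-n) = f n) (n : ℤ) :
    f (-n - 1 + 1) - f (-n - 1) = -(f (n + 1) - f n) := by
  rw [sub_add_cancel, hf n, show -n - 1 = -(n + 1) by ring, hf (n + 1)]
  ring

/-- **An even function's first differences are controlled by its second differences**: if `f(−n) = f(n)` and
`|f(j+1) − 2f(j) + f(j−1)| ≤ B` for all `j`, then `|f(n+1) − f(n)| ≤ (|n| + 1)·B`. [folklore] -/
theorem abs_forwardDiff_le_of_even {f : ℤ → ℝ} (hf : ∀ n, f (-n) = f n) {B : ℝ}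
    (hB : ∀ j, |f (j + 1) - 2 * f j + f (j - 1)| ≤ B) (n : ℤ) :
    |f (n + 1) - f n| ≤ (|n| + 1) * B := by
  have hB0 : 0 ≤ B := (abs_nonneg _).trans (hB 0)
  -- `g(0) = ½ (second difference at 0)` by evenness
  have h0 : |f (0 + 1) - f 0| ≤ B / 2 := by
    have h := hB 0
    rw [zero_add, zero_sub, hf 1] at h
    rw [zero_add]
    have : f 1 - f 0 = (f 1 - 2 * f 0 + f 1) / 2 := by ring
    rw [this, abs_div, abs_two]
    linarith
  -- nonnegative `n` by induction
  have hpos : ∀ k : ℕ, |f ((k : ℤ) + 1) - f k| ≤ ((k : ℝ) + 1) * B := by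
    intro k
    induction k with
    | zero => simpa using h0.trans (by linarith : B / 2 ≤ (0 + 1) * B)
    | succ k ih =>
      have hstep := hB ((k : ℤ) + 1)
      rw [add_sub_cancel_right] at hstep
      have : f ((k : ℤ) + 1 + 1) - f ((k : ℤ) + 1)
          = (f ((k : ℤ) + 1 + 1) - 2 * f ((k : ℤ) + 1) + f k) + (f ((k : ℤ) + 1) - f k) := by ring
      push_cast
      rw [this]
      refine (abs_add_le _ _).trans ?_
      have : ((k : ℝ) + 1 + 1) * B = B + ((k : ℝ) + 1) * B := by ring
      rw [this]
      exact add_le_add hstep ih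
  -- all integers by the oddness of `g`
  rcases Int.eq_nat_or_neg n with ⟨k, rfl | rfl⟩
  · simpa [Nat.abs_cast] using hpos k
  · rcases k with _ | k
    · simpa using h0.trans (by linarith : B / 2 ≤ (0 + 1) * B)
    · -- `n = −(k+1)`: `g(n) = −g(k)`
      have hodd := forwardDiff_neg_sub_one_of_even hf (k : ℤ)
      have hk := hpos k
      have e1 : (-((k + 1 : ℕ) : ℤ)) = -(k : ℤ) - 1 := by push_cast; ring
      rw [e1, hodd, abs_neg]
      refine hk.trans ?_
      have habs : |(-(k : ℝ) - 1)| = (k : ℝ) + 1 := by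
        rw [show -(k : ℝ) - 1 = -((k : ℝ) + 1) by ring, abs_neg, abs_of_nonneg (by positivity)]
      have : ((|(-(k : ℤ) - 1)| : ℤ) : ℝ) = (k : ℝ) + 1 := by
        rw [Int.cast_abs]; push_cast; exact habs
      rw [this]
      nlinarith

/-! ## Reflection-symmetric translation-invariant kernels -/

variable {G : Type*} [AddCommGroup G]

/-- **A first difference of a reflection-symmetric convolution kernel is controlled by its second differences**:
if `C` is translation invariant, `C (τ x) (τ y) = C x y` for a map `τ` with `τ 0 = 0` reversing the step `g` about `w`
(`τ (w + n•g) = w − n•g` for all `n : ℤ`), and `|∇_g∇_g C (x', x' + w + n'•g)| ≤ B` for all `x', n'`, then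
`|∇_g C (x, x + w + n•g)| ≤ (|n| + 2)·B`. [folklore] -/
theorem abs_rowDiff_le_of_reflection {C : Matrix G G ℝ} (hC : IsTranslationInvariant C) (τ : G → G)
    (hτC : ∀ x y, C (τ x) (τ y) = C x y) (hτ0 : τ 0 = 0) {w g : G} (hτ : ∀ n : ℤ, τ (w + n • g) = w + (-n) • g)
    {B : ℝ} (hB : ∀ (x' : G) (n' : ℤ), |rowDiffs [g, g] C x' (x' + w + n' • g)| ≤ B) (x : G) (n : ℤ) :
    |rowDiff g C x (x + w + n • g)| ≤ (|n| + 2) * B := by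
  -- the profile `f(j) = C(0, w + j•g)` is even
  set f : ℤ → ℝ := fun j => C 0 (w + j • g) with hf
  have heven : ∀ j, f (-j) = f j := by
    intro j
    simp only [hf]
    rw [show w + (-j) • g = τ (w + j • g) from (hτ j).symm, ← hτC 0 (w + j • g), hτ0]
  -- kernel entries through `f`
  have hentry : ∀ (x' : G) (j : ℤ) (a : ℤ), C (x' + a • g) (x' + w + j • g) = f (j - a) := by
    intro x' j a
    simp only [hf]
    rw [hC.apply_eq (x' + a • g) (x' + w + j • g)]
    congr 1
    rw [sub_smul]; abel
  have hentry0 : ∀ (x' : G) (j : ℤ), C x' (x' + w + j • g) = f j := by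
    intro x' j
    have := hentry x' j 0
    rwa [zero_smul, add_zero, sub_zero] at this
  -- second differences of `f` are the second differences of the kernel
  have hB' : ∀ j, |f (j + 1) - 2 * f j + f (j - 1)| ≤ B := by
    intro j
    have h := hB 0 (j + 1)
    simp only [rowDiffs_cons, rowDiffs_nil, rowDiff_apply] at h
    have e2 : C (0 + g + g) (0 + w + (j + 1) • g) = f (j - 1) := by
      have := hentry 0 (j + 1) 2
      rw [show (0 : G) + (2 : ℤ) • g = 0 + g + g by rw [two_zsmul, add_assoc]] at this
      rw [this]; congr 1; ring
    have e1 : C (0 + g) (0 + w + (j + 1) • g) = f j := by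
      have := hentry 0 (j + 1) 1
      rw [one_zsmul] at this
      rw [this]; congr 1; ring
    have e0 : C 0 (0 + w + (j + 1) • g) = f (j + 1) := hentry0 0 (j + 1)
    rw [e2, e1, e0] at h
    have : f (j - 1) - f j - (f j - f (j + 1)) = f (j + 1) - 2 * f j + f (j - 1) := by ring
    rwa [this] at h
  -- the first difference of the kernel is `f(n−1) − f(n)`
  have hfirst : rowDiff g C x (x + w + n • g) = -(f (n - 1 + 1) - f (n - 1)) := by
    rw [rowDiff_apply, sub_add_cancel]
    have e1 : C (x + g) (x + w + n • g) = f (n - 1) := by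
      have := hentry x n 1
      rwa [one_zsmul] at this
    rw [e1, hentry0 x n]
    ring
  rw [hfirst, abs_neg]
  refine (abs_forwardDiff_le_of_even heven hB' (n - 1)).trans ?_
  have hB0 : 0 ≤ B := (abs_nonneg _).trans (hB 0 0)
  have : ((|n - 1| : ℤ) : ℝ) ≤ (|n| : ℤ) + 1 := by
    have h := abs_sub (n : ℤ) 1
    rw [abs_one] at h
    exact_mod_cast h
  nlinarith

end Literature.Analysis.Fourier

end
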